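import Summits.BirchSwinnertonDyer.Rank1Residual.AdditivePotMult.RankZeroIndexBound
import Literature.NumberTheory.EllipticCurves.Rank1Residual.PrintShapeTorsion
import Literature.NumberTheory.EllipticCurves.MatarNekovar2019.ShaVanishing
import Literature.NumberTheory.EllipticCurves.MatarNekovar2019.ShaIndexBoundIrreducible
import Literature.NumberTheory.EllipticCurves.HeegnerHypothesisKroneckerProofs
import Literature.NumberTheory.EllipticCurves.ModularityVersionApProofs
import HarnessLib

/-!
# Rank ZERO at an additive (indeed ANY) odd prime, IRREDUCIBLE but NOT necessarily surjective `ρ̄_{E,p}`: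
# the Heegner-index certificate / bound of a rank-one twist field closes the pair — the first per-pair
# lever on the cell E-ii (X4(M) ∧ ¬Surj, rank 0) (cell `b2b-bsdres`, sub-cell additive-p1, gen 13)

HONEST FRAMING (cell `b2b-bsdres`, run/shared/lean/b2b/bsd-rank1-residual/, verbatim in every
file): the goal of the cell is to DELETE the COMBINATION-SHAPED residual classes of the
Birch–Swinnerton-Dyer formula for ALL analytic-rank `≤ 1` elliptic curves over `ℚ` — "full BSD
formula for every rank `≤ 1` curve in class `C`" assembled STRICTLY from published theorems — so
that the rank-`≤ 1` remainder becomes exactly the CONSTRUCTION-SHAPED classes, which are TYPED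
(missing-input `Prop`s), NOT attempted. This is not "finishing BSD". Sub-cell additive-p1 is a
RESEARCH ROUTE on the construction-shaped classes X3♯(M) / X4(M) (additive, potentially
multiplicative `p`); no claim beyond the stated sub-classes; X3/X4 labels are UNCHANGED by this file;
NOTHING is booked here (a per-pair closure is the referee's ruling on the lane's certificates).

THEOREMS ONLY (no definition, no named fact). PER PAIR (a certificate shape), not a class theorem.

## What this file records

RESIDUAL-MAP §E, cell E-ii = X4(M) ∧ ¬Surj(p) ∧ `r_an = 0` (116 S-b pairs: `p = 3`: 93 with image
`3Ns`/`3Nn`, `p = 5`: 23 with `5Ns`/`5S4`; window 7605u1, 11520bl1, 15210bl1, 15210x1): "NEEDS X_E1 +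
an image input — upper half typed, not class-wide" — Kato's divisibility on the `ω^{(p−1)/2}`-component
needs `ρ_{E♭,p^∞}` onto, and Wuthrich 2014 Prop. 21 excludes exactly the primes "for which the Galois
representation on `E[p]` is neither surjective nor contained in a Borel". No lever reached these pairs.
KOLYVAGIN does, per pair, with NO surjectivity: for a rank-ZERO `E` and an imaginary quadratic Heegner
field `K` whose Heegner point `y_K ∈ E(K)` has infinite order (the twist `E^{(d_K)}` has rank one),
Matar–Nekovář, JTNB 31 (2019), Thm. 6.7 (1) — tree fact `MatarNekovar2019.thm67_sha_primary_trivial_of_irreducible`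
(cell row A58) — gives `Ш(E/K)[p^∞] = 0` from `y_K ∉ pE(K)` for `p` odd with `E[p]` IRREDUCIBLE and
`(K,p) ≠ (ℚ(√−3),3)`; `Ш(E/ℚ)[p] ↪ Ш(E/K)[p]` (`p` odd), so `Ш(E/ℚ)[p] = 0`; with the rank-zero print
shape (`L(E,1)/Ω_E = q`, `ord_p q = ord_p #Ш + ord_p ∏c_ℓ − 2 ord_p #E(ℚ)_tors`; here `p ∤ ∏c_ℓ`,
`p ∤ #E(ℚ)_tors` by irreducibility, `ord_p q = 0`) this is `BSD(E,p)`. For the rows with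
`p^{2k} ∥ #Ш_an(E)`, Thm. 0.3 (tree fact `…thm03_padicValNat_card_sha_le_of_irreducible`, A91,
`d_K ≠ −3, −4`) gives the index BOUND form `ord_p #Ш(E) ≤ 2·ord_p [E(K):ℤy_K]` (gen 5's
`RankZeroIndexBound.lean` with `Surj` replaced by `Irr`), closing with a descent certificate
`p^{2k−1} ∣ #Ш(E)` and Cassels–Tate. The reading theorems are class-agnostic (any additive X4 pair, and
verbatim X7/X9/X10 rank-zero rows with irreducible non-surjective image).

Census (this seat, census-g13/nonsurj_census_r0.py over the lane's CURRENT residue, `N < 5·10⁵`):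
rank-0 residue pairs with an open odd additive X4-cell and IRREDUCIBLE NON-surjective image: 1 049
(`p = 3`: 3Ns/3Nn; `5`: 5Ns/5Nn/5S4; `7`: 7Ns/7Nn; `13`: 13S4) — of which (M): 116 (= E-ii exactly).
Tamagawa-free (`p ∤ #E(ℚ)_tors·∏c_ℓ`) ∧ optimal ∧ Manin 1 ∧ `#Ш_an = 1`: 402 (43 of them (M)); the
certificate campaign (two engines) is REPORT §18 / census-g13. Nothing booked here.

* §1 exact certificate (A58): `bsdp_rankZero_of_indexCertificate_of_irr` (any level `N`),
  readings `ClassX4M.bsdp_rankZero_of_indexCertificate`, `ClassX4.bsdp_rankZero_of_indexCertificate_of_odd`.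
* §2 index bound (A91): `padicValNat_shaOrder_le_of_indexBound_of_irr`,
  `bsdp_rankZero_of_indexBound_of_pow_dvd_of_irr`, `bsdp_rankZero_of_indexBound_of_exists_torsion_of_irr`,
  reading `ClassX4.bsdp_rankZero_of_indexBound_of_exists_torsion_of_odd`.

References: [MatarNekovar2019] Thm. 6.7 (1), Thm. 0.3, §0.11, Cor. 5.21, Prop. 5.26; [MatarNekovar2021Correction];
[Wuthrich2014] Prop. 21; [SilvermanAEC2009] Thm. X.4.14; [Skinner2016PacificMC] Thm. C (print shape);
[Miller2011LMS] Def. 1.1; [DokchitserDokchitserAnnals2010] Lemma 4.14.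
-/

noncomputable section

open scoped Classical NumberField

open WeierstrassCurve NumberField Literature.NumberTheory.EllipticCurves
  Literature.NumberTheory.EllipticCurves.ModularForms
  Literature.NumberTheory.EllipticCurves.Rank1Residual
  Literature.NumberTheory.EllipticCurves.Rank1Residual.Typed
  Literature.NumberTheory.QuadraticFields
  Literature.NumberTheory.Automorphic
  IsDedekindDomain

namespace Summit.BirchSwinnertonDyer.Rank1Residual.AdditivePotMult

/-! ### §1 Rank zero: the EXACT Heegner-index certificate, `E[p]` irreducible (Matar–Nekovář Thm. 6.7 (1)) -/

/-- **Rank `0`, ANY odd `p` (additive included), `E[p]` IRREDUCIBLE — no surjectivity —: `BSD(E,p)` from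
the exact Heegner-index certificate of a rank-one twist field.** `W/ℚ` globally minimal with
`ord_{s=1} L(E,s) = 0`; `K` imaginary quadratic with the Heegner hypothesis for the level `N`,
`(K,p) ≠ (ℚ(√−3),3)`; `P = y_K ∈ E(K)` a Heegner point of INFINITE ORDER (the twist `E^{(d_K)}` has
rank one). CERTIFICATE: `p ∤ [E(K):ℤP]`, `L(E,1)/Ω_E = q` with `ord_p q = 0`, `p ∤ ∏_ℓ c_ℓ(E)`.
Proof: Matar–Nekovář (`hMN`, PUBLISHED named fact) gives `Ш(E/K)[p^∞] = 0`, restriction gives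
`Ш(E/ℚ)[p] = 0` (`Typed.noPTorsion_of_matarNekovar_of_not_dvd_index`), `Ш(E/ℚ)` is finite (GZK `hGZK`),
so `ord_p #Ш(E) = 0`; `p ∤ #E(ℚ)_tors` by irreducibility (Mazur); the rank-zero print shape
(`bsdp_of_pPartRankZero`, modularity `hmod`) finishes. Per pair; nothing booked; class-agnostic.
[cite: MatarNekovar2019, Thm. 6.7 (1) (p. 498)] [cite: Skinner2016PacificMC, Thm. C (display, print shape only)]
[cite: Miller2011LMS, §1 and Def. 1.1] -/
theorem bsdp_rankZero_of_indexCertificate_of_irr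
    (W : WeierstrassCurve ℚ) [W.IsElliptic] [W.IsGloballyMinimal] (p : ℕ) [Fact p.Prime]
    (hmod : hasEntireLFunction_rat) (hGZK : rank_eq_analyticRank_of_analyticRank_le_one)
    {N : ℕ} [NeZero N] {K : Type} [Field K] [NumberField K]
    (hMN : MatarNekovar2019.thm67_sha_primary_trivial_of_irreducible N W K)
    (hK : IsImaginaryQuadratic K) (hH : SatisfiesHeegnerHypothesis N K)
    (h3 : p = 3 → NumberField.discr K ≠ -3)
    {P : (W.baseChange K).toAffine.Point} (hP : IsHeegnerPoint N W K P) (hnt : ¬ IsOfFinAddOrder P)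
    (hp2 : p ≠ 2) (hirr : Irr W p) (hr : W.analyticRank = 0)
    -- the certificate
    (hI : ¬ p ∣ (AddSubgroup.zmultiples P).index)
    (q : ℚ) (hq : W.entireLFunction 1 / (W.realPeriodRat : ℂ) = (q : ℂ)) (hv : padicValRat p q = 0)
    (htam : ¬ p ∣ W.tamagawaProduct) :
    BSDp W p := by
  have h0 : ∀ x : W.sha, (p : ℤ) • x = 0 → x = 0 :=
    noPTorsion_of_matarNekovar_of_not_dvd_index W p hMN hK hH hP hnt hp2 hirr h3 hI
  have hfin : W.ShaFinite := (hGZK W (by rw [hr]; norm_num)).2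
  have hsha : padicValNat p W.shaOrder = 0 := padicValNat_shaOrder_eq_zero_of_noPTorsion W p hfin h0
  have htors : padicValNat p W.torsionOrder = 0 :=
    padicValNat_torsionOrder_eq_zero_of_irreducible W p hirr
  refine bsdp_of_pPartRankZero W p hmod hGZK hr ⟨q, hq, ?_⟩
  rw [hv, hsha, padicValNat.eq_zero_of_not_dvd htam, htors]
  simp

variable {W : WeierstrassCurve ℚ} [W.IsElliptic] {p : ℕ} [Fact p.Prime]

/-- **X4(M), rank `0`, ANY odd `p` — NO image hypothesis (cell E-ii included): `BSD(E,p)` from the exact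
Heegner-index certificate** at a Heegner field for `N_E` (`p ∣ N_E` is additive, so `p` splits in `K`
and `(K,p) ≠ (ℚ(√−3),3)` is automatic). CERTIFICATE: `y_K` of infinite order, `p ∤ [E(K):ℤy_K]`,
`L(E,1)/Ω_E = q` with `ord_p q = 0`, `p ∤ ∏_ℓ c_ℓ(E)`. Target rows (census-g13): the 116 E-ii pairs
(`3Ns`/`3Nn`/`5Ns`/`5S4`), 64 of them Tamagawa-free, 54 with `ord_p #Ш_an = 0`. Per pair; X4(M) stays
CONSTRUCTION-SHAPED; nothing booked. [cite: MatarNekovar2019, Thm. 6.7 (1) (p. 498)]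
[cite: Miller2011LMS, §1 and Def. 1.1] -/
theorem ClassX4M.bsdp_rankZero_of_indexCertificate [W.IsGloballyMinimal] [NeZero (W.conductorNorm ℤ)]
    (hX : ClassX4M W p) (hr : W.analyticRank = 0)
    (hmod : hasEntireLFunction_rat) (hGZK : rank_eq_analyticRank_of_analyticRank_le_one)
    {K : Type} [Field K] [NumberField K]
    (hMN : MatarNekovar2019.thm67_sha_primary_trivial_of_irreducible (W.conductorNorm ℤ) W K)
    (hK : IsImaginaryQuadratic K) (hH : SatisfiesHeegnerHypothesis (W.conductorNorm ℤ) K)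
    {P : (W.baseChange K).toAffine.Point} (hP : IsHeegnerPoint (W.conductorNorm ℤ) W K P)
    (hnt : ¬ IsOfFinAddOrder P)
    (hI : ¬ p ∣ (AddSubgroup.zmultiples P).index)
    (q : ℚ) (hq : W.entireLFunction 1 / (W.realPeriodRat : ℂ) = (q : ℂ)) (hv : padicValRat p q = 0)
    (htam : ¬ p ∣ W.tamagawaProduct) :
    BSDp W p := by
  have hp : p.Prime := Fact.out
  have hpN : p ∣ W.conductorNorm ℤ :=
    (W.dvd_conductorNorm_iff_not_hasGoodReductionAtPrime p).mpr (not_good_of_addv W p hX.1.2.1)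
  have hpd : ¬ (p : ℤ) ∣ NumberField.discr K :=
    Literature.SatisfiesHeegnerHypothesis.not_dvd_discr hK.1 hH hp hpN
  have h3 : p = 3 → NumberField.discr K ≠ -3 := by
    rintro rfl h
    exact hpd ⟨-1, by rw [h]; norm_num⟩
  exact bsdp_rankZero_of_indexCertificate_of_irr W p hmod hGZK hMN hK hH h3 hP hnt hX.p_ne_two hX.irr
    hr hI q hq hv htam

/-- **X4 (ANY additive type), rank `0`, ANY odd `p` — NO image hypothesis beyond the class's own
irreducibility: `BSD(E,p)` from the exact Heegner-index certificate.** Class-agnostic offer to the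
potentially-good seats: the lane-residue rows "NONSURJ" of additive-p4's X4♯ end-state
(`x4Sharp_iff_residues`; census-g13: 933 (G) rank-0 pairs, 359 Tamagawa-free with `#Ш_an = 1`) are
certificate-shaped by this reading. Per pair; labels unchanged; nothing booked.
[cite: MatarNekovar2019, Thm. 6.7 (1) (p. 498)] [cite: Miller2011LMS, §1 and Def. 1.1] -/
theorem ClassX4.bsdp_rankZero_of_indexCertificate_of_odd [W.IsGloballyMinimal]
    [NeZero (W.conductorNorm ℤ)]
    (hX : ClassX4 W p) (hr : W.analyticRank = 0)
    (hmod : hasEntireLFunction_rat) (hGZK : rank_eq_analyticRank_of_analyticRank_le_one)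
    {K : Type} [Field K] [NumberField K]
    (hMN : MatarNekovar2019.thm67_sha_primary_trivial_of_irreducible (W.conductorNorm ℤ) W K)
    (hK : IsImaginaryQuadratic K) (hH : SatisfiesHeegnerHypothesis (W.conductorNorm ℤ) K)
    {P : (W.baseChange K).toAffine.Point} (hP : IsHeegnerPoint (W.conductorNorm ℤ) W K P)
    (hnt : ¬ IsOfFinAddOrder P)
    (hI : ¬ p ∣ (AddSubgroup.zmultiples P).index)
    (q : ℚ) (hq : W.entireLFunction 1 / (W.realPeriodRat : ℂ) = (q : ℂ)) (hv : padicValRat p q = 0)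
    (htam : ¬ p ∣ W.tamagawaProduct) :
    BSDp W p := by
  have hp : p.Prime := Fact.out
  have hpN : p ∣ W.conductorNorm ℤ :=
    (W.dvd_conductorNorm_iff_not_hasGoodReductionAtPrime p).mpr (not_good_of_addv W p hX.2.1)
  have hpd : ¬ (p : ℤ) ∣ NumberField.discr K :=
    Literature.SatisfiesHeegnerHypothesis.not_dvd_discr hK.1 hH hp hpN
  have h3 : p = 3 → NumberField.discr K ≠ -3 := by
    rintro rfl h
    exact hpd ⟨-1, by rw [h]; norm_num⟩
  exact bsdp_rankZero_of_indexCertificate_of_irr W p hmod hGZK hMN hK hH h3 hP hnt hX.1 hX.2.2 hr hI q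
    hq hv htam

/-! ### §2 Rank zero: the Heegner-index BOUND, `E[p]` irreducible (Matar–Nekovář Thm. 0.3) -/

/-- **`ord_p #Ш(E/ℚ) ≤ 2k` from a Heegner-index bound `ord_p [E(K):ℤP] ≤ k`, ANY odd `p` with `E[p]`
IRREDUCIBLE (no surjectivity), ANY reduction type at `p`, `d_K ≠ −3, −4`.** Gen 5's
`padicValNat_shaOrder_le_of_indexBound` with Kolyvagin's bound taken in Matar–Nekovář's
irreducible-image form (`hMN`, tree fact A91) instead of McCallum's surjective one: `Ш(E/K)` finite
(`kolyvagin` `hKo`), `ord_p #Ш(E/K) ≤ 2·ord_p [E(K):ℤP]`, and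
`ord_p #Ш(E/K) = ord_p #Ш(E) + ord_p #Ш(E^{d_K})` for odd `p` (`padicValNat_shaOrder_baseChange`).
Per pair. [cite: MatarNekovar2019, Thm. 0.3 (p. 456), §0.11 (p. 457), Cor. 5.21 (e′), Prop. 5.26 (2)]
[cite: DokchitserDokchitserAnnals2010, Lemma 4.14] -/
theorem padicValNat_shaOrder_le_of_indexBound_of_irr
    (W : WeierstrassCurve ℚ) [W.IsElliptic] (p : ℕ) [Fact p.Prime]
    {N : ℕ} [NeZero N] {K : Type} [Field K] [NumberField K]
    (hKo : kolyvagin N W K) (hMN : MatarNekovar2019.thm03_padicValNat_card_sha_le_of_irreducible N W K)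
    (hK : IsImaginaryQuadratic K) (hH : SatisfiesHeegnerHypothesis N K)
    (hD3 : NumberField.discr K ≠ -3) (hD4 : NumberField.discr K ≠ -4)
    {P : (W.baseChange K).toAffine.Point} (hP : IsHeegnerPoint N W K P) (hnt : ¬ IsOfFinAddOrder P)
    (hp2 : p ≠ 2) (hirr : Irr W p) {k : ℕ}
    (hI : padicValNat p (AddSubgroup.zmultiples P).index ≤ k) :
    W.ShaFinite ∧ padicValNat p W.shaOrder ≤ 2 * k := by
  have hp : p.Prime := Fact.out
  obtain ⟨-, hfinK⟩ := hKo hK hH hP hnt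
  -- the twist model and finiteness downstairs
  have hD0 : (NumberField.discr K : ℚ) ≠ 0 := by exact_mod_cast NumberField.discr_ne_zero K
  haveI hEt : (W.quadraticTwist (NumberField.discr K : ℚ)).IsElliptic :=
    W.isElliptic_quadraticTwist hD0
  have hWd : (1 : VariableChange ℚ) • W.quadraticTwist (NumberField.discr K : ℚ) =
      W.quadraticTwist (NumberField.discr K : ℚ) := one_smul _ _
  have hW' : (1 : VariableChange K) • W.baseChange K = W.baseChange K := one_smul _ _
  haveI : (W.baseChange K).IsElliptic := by rw [WeierstrassCurve.baseChange]; infer_instance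
  have hfinW : W.ShaFinite := W.shaFinite_of_shaFinite_smul_baseChange K hW' hfinK
  have hfinD : (W.quadraticTwist (NumberField.discr K : ℚ)).ShaFinite :=
    W.shaFinite_twist_of_shaFinite_smul_baseChange K hK.1 hWd hW' hfinK
  -- `ord_p #Ш(E/K) = ord_p #Ш(E) + ord_p #Ш(E^{d_K})`
  have hsum := padicValNat_shaOrder_baseChange W p K (W.quadraticTwist (NumberField.discr K : ℚ))
    (W.baseChange K) hp2 hK.1 ⟨1, hWd⟩ ⟨1, hW'⟩ hfinW hfinD hfinK
  -- Matar–Nekovář's form of Kolyvagin's bound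
  have hbound := hMN hK hH hD3 hD4 hP hnt hp hp2 hirr
  refine ⟨hfinW, ?_⟩
  have hK' : padicValNat p (W.baseChange K).shaOrder ≤ 2 * k := by
    unfold WeierstrassCurve.shaOrder
    exact hbound.trans (Nat.mul_le_mul_left 2 hI)
  omega

/-- **Rank `0`, ANY odd `p` (additive included), `E[p]` IRREDUCIBLE, `ord_p #Ш(E)_an = 2k`: the index
bound `ord_p [E(K):ℤP] ≤ k` (upper half, Matar–Nekovář) and the descent certificate `p^{2k−1} ∣ #Ш(E/ℚ)`
(lower half, Cassels–Tate squareness `hCT`) give `BSD(E,p)`** (`d_K ≠ −3, −4`). Gen 5's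
`bsdp_rankZero_of_indexBound_of_pow_dvd` with `Surj` replaced by `Irr`. Per pair; nothing booked.
[cite: MatarNekovar2019, Thm. 0.3 (p. 456), §0.11 (p. 457)] [cite: SilvermanAEC2009, Thm. X.4.14]
[cite: Miller2011LMS, §1 and Def. 1.1] -/
theorem bsdp_rankZero_of_indexBound_of_pow_dvd_of_irr
    (W : WeierstrassCurve ℚ) [W.IsElliptic] (p : ℕ) [Fact p.Prime]
    (hCT : exists_casselsTate_pairing (K := ℚ)) (hGZK : rank_eq_analyticRank_of_analyticRank_le_one)
    {N : ℕ} [NeZero N] {K : Type} [Field K] [NumberField K]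
    (hKo : kolyvagin N W K) (hMN : MatarNekovar2019.thm03_padicValNat_card_sha_le_of_irreducible N W K)
    (hK : IsImaginaryQuadratic K) (hH : SatisfiesHeegnerHypothesis N K)
    (hD3 : NumberField.discr K ≠ -3) (hD4 : NumberField.discr K ≠ -4)
    {P : (W.baseChange K).toAffine.Point} (hP : IsHeegnerPoint N W K P) (hnt : ¬ IsOfFinAddOrder P)
    (hp2 : p ≠ 2) (hirr : Irr W p) (hr : W.analyticRank = 0) {k : ℕ}
    (hI : padicValNat p (AddSubgroup.zmultiples P).index ≤ k)
    {q : ℚ} (hq : shaAn W = (q : ℂ)) (hv : padicValRat p q = 2 * k)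
    (hdvd : p ^ (2 * k - 1) ∣ W.shaOrder) : BSDp W p := by
  obtain ⟨hfin, hle⟩ :=
    padicValNat_shaOrder_le_of_indexBound_of_irr W p hKo hMN hK hH hD3 hD4 hP hnt hp2 hirr hI
  -- lower half: Cassels–Tate squareness and the certificate
  obtain ⟨q', hq', hlow⟩ :=
    missingLowerBoundAt_of_casselsTate_of_pow_dvd W p hCT hfin hq (k := k) (le_of_eq hv) hdvd
  have hqq : q' = q := by exact_mod_cast hq'.symm.trans hq
  subst hqq
  refine bsdp_of_missingPPartAt W p hGZK (by rw [hr]; norm_num) ⟨q', hq', le_antisymm hlow ?_⟩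
  rw [hv]; exact_mod_cast hle

/-- **The `k = 1` shape (`#Ш(E)_an = p²·unit`), `E[p]` IRREDUCIBLE: ONE descent certificate
`Ш(E/ℚ)[p] ≠ 0` and ONE Heegner field (`d_K ≠ −3, −4`) with `ord_p [E(K):ℤP] ≤ 1`** ⟹ `BSD(E,p)`
(rank `0`, odd `p`, any reduction type). Per pair; nothing booked.
[cite: MatarNekovar2019, Thm. 0.3 (p. 456), §0.11 (p. 457)] [cite: SilvermanAEC2009, Thm. X.4.14]
[cite: Miller2011LMS, §1 and Def. 1.1] -/
theorem bsdp_rankZero_of_indexBound_of_exists_torsion_of_irr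
    (W : WeierstrassCurve ℚ) [W.IsElliptic] (p : ℕ) [Fact p.Prime]
    (hCT : exists_casselsTate_pairing (K := ℚ)) (hGZK : rank_eq_analyticRank_of_analyticRank_le_one)
    {N : ℕ} [NeZero N] {K : Type} [Field K] [NumberField K]
    (hKo : kolyvagin N W K) (hMN : MatarNekovar2019.thm03_padicValNat_card_sha_le_of_irreducible N W K)
    (hK : IsImaginaryQuadratic K) (hH : SatisfiesHeegnerHypothesis N K)
    (hD3 : NumberField.discr K ≠ -3) (hD4 : NumberField.discr K ≠ -4)
    {P : (W.baseChange K).toAffine.Point} (hP : IsHeegnerPoint N W K P) (hnt : ¬ IsOfFinAddOrder P)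
    (hp2 : p ≠ 2) (hirr : Irr W p) (hr : W.analyticRank = 0)
    (hI : padicValNat p (AddSubgroup.zmultiples P).index ≤ 1)
    {q : ℚ} (hq : shaAn W = (q : ℂ)) (hv : padicValRat p q = 2)
    (htor : ∃ x : W.sha, x ≠ 0 ∧ p • x = 0) : BSDp W p :=
  bsdp_rankZero_of_indexBound_of_pow_dvd_of_irr W p hCT hGZK hKo hMN hK hH hD3 hD4 hP hnt hp2 hirr hr
    (k := 1) hI hq (by rw [hv]; norm_num) (by simpa using dvd_shaOrder_of_exists_torsion W p htor)

/-- **X4 (any additive type; in particular X4(M), cell E-ii), rank `0`, ANY odd `p`,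
`#Ш(E)_an = p²·(p-adic unit)`, NO image hypothesis: `BSD(E,p)` from ONE Heegner field with `d_K < −4`
and `ord_p [E(K):ℤP] ≤ 1` plus the descent certificate `Ш(E)[p] ≠ 0`.** Target rows (census-g13):
the E-ii pairs with `#Ш_an = 9` at `p = 3` (5 (M) + 6 (G) in the lane residue). Gen 5's
`ClassX4.bsdp_three_rankZero_of_indexBound_of_exists_torsion` freed of `Surj` and of `p = 3`.
Per pair; labels unchanged; nothing booked. [cite: MatarNekovar2019, Thm. 0.3 (p. 456), §0.11 (p. 457)]
[cite: SilvermanAEC2009, Thm. X.4.14] [cite: Miller2011LMS, §1 and Def. 1.1] -/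
theorem ClassX4.bsdp_rankZero_of_indexBound_of_exists_torsion_of_odd
    (hX : ClassX4 W p)
    (hCT : exists_casselsTate_pairing (K := ℚ)) (hGZK : rank_eq_analyticRank_of_analyticRank_le_one)
    {N : ℕ} [NeZero N] {K : Type} [Field K] [NumberField K]
    (hKo : kolyvagin N W K) (hMN : MatarNekovar2019.thm03_padicValNat_card_sha_le_of_irreducible N W K)
    (hK : IsImaginaryQuadratic K) (hH : SatisfiesHeegnerHypothesis N K)
    (hdK : NumberField.discr K < -4)
    {P : (W.baseChange K).toAffine.Point} (hP : IsHeegnerPoint N W K P) (hnt : ¬ IsOfFinAddOrder P)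
    (hr : W.analyticRank = 0)
    (hI : padicValNat p (AddSubgroup.zmultiples P).index ≤ 1)
    {q : ℚ} (hq : shaAn W = (q : ℂ)) (hv : padicValRat p q = 2)
    (htor : ∃ x : W.sha, x ≠ 0 ∧ p • x = 0) : BSDp W p :=
  bsdp_rankZero_of_indexBound_of_exists_torsion_of_irr W p hCT hGZK hKo hMN hK hH (by omega) (by omega)
    hP hnt hX.1 hX.2.2 hr hI hq hv htor

end Summit.BirchSwinnertonDyer.Rank1Residual.AdditivePotMult

end
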